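import Mathlib
import Summits.NavierStokesRegularity.NavierStokesRegularity.Theorems.EulerZoomLiouvillePowerGaugeEulerLiouvilleSelfSimilarSublinearLoc
import HarnessLib.Audit

/-!
# Rung C1 of the crux `EulerZoomLiouville.PowerGaugeEulerLiouville` (sub-stratum W3b): A `C²` PROFILE SLOWER THAN THE
# SIMILARITY DRIFT AT INFINITY IS IRROTATIONAL — barrier confinement at the sharp threshold `limsup ‖U(y)‖/‖y‖ < γ`

Route №10 `EulerZoomLiouville` (NavierStokesRegularity), crux E = stmt-NavierStokesRegularity-19832, tenure rung C1,
registered residue `stub_selfSimilarExtremalRest`, sub-stratum W3b («`C²` profiles UNBOUNDED at infinity»).  Lineage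
ns-typeII-p1 (gen 8).  Sequel to `…SelfSimilarSublinearLoc` (`Loc.curl_eq_zero_of_sublinear`: `U(y) = o(|y|)` ⇒ `curl U ≡ 0`).

The barrier of `…SelfSimilarSublinearConfinement` needs only that the profile be SLOWER THAN THE DRIFT at infinity:
if `‖U(y)‖ ≤ κ‖y‖` for `‖y‖ ≥ R` with `κ < γ`, then `d/ds ½‖Y‖² = γ‖Y‖² + ⟪Y, U(Y)⟫ ≥ (γ − κ)‖Y‖² > 0` outside the ball `R`,
so every large sphere is a barrier for the backward similarity flow and the cutoff localisation runs verbatim.  The threshold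
is sharp for CONFINEMENT: for the linear strain `U = Ay` (BS15 (1.9), a profile for every `γ`) with an eigenvalue of `γI + A`
negative, backward orbits escape to infinity along the corresponding eigendirection.

* `norm_flow_le_max_of_nonpos_of_lt` — barrier confinement for `Ṽ ∈ C¹`, `‖DṼ‖ ≤ K`, `‖Ṽ y‖ ≤ κ‖y‖` (`‖y‖ ≥ R > 0`), `κ < γ`;
* **`curl_eq_zero_of_subdrift`** — `(U, P)` a self-similar Euler profile (CIV (3.3); so `U ∈ C²`), `0 < γ < ½`,
  `‖U y‖ ≤ κ‖y‖` for `‖y‖ ≥ R₁`, `κ < γ` ⇒ `curl U ≡ 0` (hence `U` is harmonic componentwise; the sequel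
  `…SelfSimilarSubdriftRigidity` concludes: `DU` bounded, `U` affine, and the member vanishes).

WHAT THIS IS NOT: not NS, not E, not rung C1 — `C²` profiles with `limsup ‖U(y)‖/‖y‖ ≥ γ` (sparse fast spikes), the weak
class (`V ∉ C²`) and all non-self-similar members remain. [folklore; ConstantinIgnatovaVicol2026Putative §3 (setting);
BronziShvydkoy2015 §1 (1.9) (linear profiles)]
-/

noncomputable section

-- flat `Theorems/<Route><Decl>…` files of one crux share the namespace of the crux (tree convention)
set_option linter.dupNamespace false

open MeasureTheory Set Filter Topology Metric Function InnerProductSpace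
open scoped RealInnerProductSpace NNReal ENNReal ContDiff

namespace Summit.NavierStokesRegularity.NavierStokesRegularity.Theorems.PowerGaugeEulerLiouville.Loc

open Literature.Analysis Literature.Analysis.FluidPDE
open Summit.NavierStokesRegularity.NavierStokesRegularity.Theorems.PowerGaugeEulerLiouville.Kelvin

variable {γ : ℝ} {U : EuclideanSpace ℝ (Fin 3) → EuclideanSpace ℝ (Fin 3)} {P : EuclideanSpace ℝ (Fin 3) → ℝ}

/-! ### Barrier confinement at the drift threshold -/

/-- **Barrier confinement at the sharp drift threshold**: for a `C¹` field `Ṽ` with `‖DṼ‖ ≤ K` and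
`‖Ṽ y‖ ≤ κ‖y‖` whenever `‖y‖ ≥ R`, with `κ < γ` (`R > 0`), every backward orbit of the similarity field `W = γy + Ṽ`
satisfies `‖Φ_s x‖ ≤ max ‖x‖ R` for `s ≤ 0`: outside the ball of radius `R` one has
`d/ds ‖Φ_s x‖² = 2γ‖Y‖² + 2⟪Y, Ṽ Y⟫ ≥ 2(γ − κ)‖Y‖² > 0`, so `t ↦ ‖Φ_{−t} x‖²` cannot cross the level `(max ‖x‖ R)²` upwards
(fencing lemma; `norm_flow_le_max_of_nonpos` is the case `κ = γ/2`). No bound on `Ṽ`, no profile equation. [folklore] -/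
theorem norm_flow_le_max_of_nonpos_of_lt {V : EuclideanSpace ℝ (Fin 3) → EuclideanSpace ℝ (Fin 3)} (hV : ContDiff ℝ 1 V)
    {K : ℝ} (hK : ∀ y, ‖fderiv ℝ V y‖ ≤ K) {κ : ℝ} (hκ : κ < γ) {R : ℝ} (hR : 0 < R)
    (hfar : ∀ y, R ≤ ‖y‖ → ‖V y‖ ≤ κ * ‖y‖) (x : EuclideanSpace ℝ (Fin 3)) {s : ℝ} (hs : s ≤ 0) :
    ‖ODE.evolutionMap (fun _ : ℝ => selfSimilarTransport γ 0 V) 0 s x‖ ≤ max ‖x‖ R := by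
  set Φ := ODE.evolutionMap (fun _ : ℝ => selfSimilarTransport γ 0 V) 0 with hΦ
  set m : ℝ := max ‖x‖ R with hm
  have hm0 : 0 < m := lt_max_of_lt_right hR
  -- `g t = ‖Φ_{−t} x‖²`, `g' t = 2⟪Y, −W(Y)⟫`
  set g : ℝ → ℝ := fun t => ‖Φ (-t) x‖ ^ 2 with hg
  set g' : ℝ → ℝ := fun t => 2 * ⟪Φ (-t) x, (-1 : ℝ) • selfSimilarTransport γ 0 V (Φ (-t) x)⟫ with hg'
  have hder : ∀ t, HasDerivAt g (g' t) t := fun t =>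
    (C2.Kelvin.hasDerivAt_flow_neg (γ := γ) hV hK x t).norm_sq
  have key : ∀ b : ℝ, ∀ ⦃t⦄, t ∈ Icc 0 b → g t ≤ m ^ 2 := by
    intro b
    refine image_le_of_deriv_right_lt_deriv_boundary' (f := g) (f' := g') (a := 0) (b := b)
      (fun t _ => (hder t).continuousAt.continuousWithinAt) (fun t _ => (hder t).hasDerivWithinAt)
      (B := fun _ => m ^ 2) (B' := fun _ => 0) ?_ continuousOn_const (fun t _ => (hasDerivAt_const t _).hasDerivWithinAt) ?_
    · -- `g 0 = ‖x‖² ≤ m²`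
      have h0 : g 0 = ‖x‖ ^ 2 := by simp [hg, hΦ, ODE.evolutionMap_self]
      rw [h0]
      exact pow_le_pow_left₀ (norm_nonneg _) (le_max_left _ _) 2
    · -- on the barrier the derivative is negative
      intro t _ hgt
      set Y := Φ (-t) x with hY
      have hYn : ‖Y‖ = m := by
        have h1 : ‖Y‖ ^ 2 = m ^ 2 := hgt
        exact (pow_left_inj₀ (norm_nonneg Y) hm0.le two_ne_zero).1 h1
      have hRY : R ≤ ‖Y‖ := by rw [hYn]; exact le_max_right _ _
      have hVY : ‖V Y‖ ≤ κ * ‖Y‖ := hfar Y hRY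
      have hinner : ⟪Y, V Y⟫ ≥ -(κ * ‖Y‖ * ‖Y‖) := by
        have h := abs_real_inner_le_norm Y (V Y)
        have h' : |⟪Y, V Y⟫| ≤ ‖Y‖ * (κ * ‖Y‖) := h.trans (mul_le_mul_of_nonneg_left hVY (norm_nonneg _))
        have := neg_abs_le ⟪Y, V Y⟫
        nlinarith
      have hcalc : g' t = -(2 * γ * ‖Y‖ ^ 2) - 2 * ⟪Y, V Y⟫ := by
        simp only [hg', ← hY, selfSimilarTransport_apply, sub_zero, inner_smul_right, inner_add_right,
          real_inner_self_eq_norm_sq]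
        ring
      rw [hcalc]
      have hm2 : 0 < ‖Y‖ ^ 2 := by rw [hYn]; positivity
      have hγκ : 0 < γ - κ := by linarith
      nlinarith [mul_pos hγκ hm2]
  have ht : -s ∈ Icc (0 : ℝ) (-s) := ⟨neg_nonneg.2 hs, le_rfl⟩
  have h := key (-s) ht
  simp only [hg, neg_neg] at h
  exact (pow_le_pow_iff_left₀ (norm_nonneg _) hm0.le two_ne_zero).1 h

/-! ### Subdrift growth ⇒ irrotational -/

/-- **A `C²` SELF-SIMILAR EULER PROFILE OF SUBDRIFT GROWTH IS IRROTATIONAL** (`0 < γ < ½`): `(U, P)` satisfies CIV (3.3)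
(so `U ∈ C²`) and `‖U y‖ ≤ κ‖y‖` for `‖y‖ ≥ R₁` with `κ < γ` (i.e. `limsup_{|y|→∞} ‖U(y)‖/‖y‖ < γ`: at infinity the profile is
slower than the similarity drift `γy`) ⇒ `curl U x₀ = 0` for every `x₀`.  Cutoff localisation around the BARRIER ball of
`ball x₀ 1`; the proof is `Loc.curl_eq_zero_of_sublinear` verbatim with the barrier `norm_flow_le_max_of_nonpos_of_lt`.
[folklore; three-lineage chain of the ns-regularity-ideate cell, localised] -/
theorem curl_eq_zero_of_subdrift (hprof : IsSelfSimilarEulerProfile γ 0 U P)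
    {κ R₁ : ℝ} (hκ : κ < γ) (hR₁ : ∀ y : EuclideanSpace ℝ (Fin 3), R₁ ≤ ‖y‖ → ‖U y‖ ≤ κ * ‖y‖)
    (hγ : 0 < γ) (hγ2 : γ < 1 / 2) (x₀ : EuclideanSpace ℝ (Fin 3)) : curl U x₀ = 0 := by
  have hU2 : ContDiff ℝ 2 U := hprof.contDiff_velocity
  have hU1 : ContDiff ℝ 1 U := hU2.of_le (by norm_num)
  -- `κ ≥ 0` may be assumed; the barrier radius `R ≥ 1`
  have hκ0 : max κ 0 < γ := max_lt hκ hγ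
  set R : ℝ := max R₁ 1 with hRdef
  have hR : 0 < R := lt_of_lt_of_le one_pos (le_max_right _ _)
  have hfarU : ∀ y : EuclideanSpace ℝ (Fin 3), R ≤ ‖y‖ → ‖U y‖ ≤ max κ 0 * ‖y‖ :=
    fun y hy => (hR₁ y ((le_max_left _ _).trans hy)).trans
      (mul_le_mul_of_nonneg_right (le_max_left _ _) (norm_nonneg _))
  -- a global linear-growth bound for `U` (continuity on the barrier ball)
  obtain ⟨B, hB⟩ := (isCompact_closedBall (0 : EuclideanSpace ℝ (Fin 3)) R).exists_bound_of_continuousOn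
    hU2.continuous.continuousOn
  have hB0 : 0 ≤ max B 0 := le_max_right _ _
  have hUlin : ∀ y : EuclideanSpace ℝ (Fin 3), ‖U y‖ ≤ max κ 0 * ‖y‖ + max B 0 := by
    intro y
    by_cases hy : ‖y‖ ≤ R
    · have h1 : ‖U y‖ ≤ B := hB y (by rwa [mem_closedBall, dist_zero_right])
      have h2 : 0 ≤ max κ 0 * ‖y‖ := mul_nonneg (le_max_right _ _) (norm_nonneg _)
      linarith [le_max_left B 0]
    · push Not at hy
      linarith [hfarU y hy.le]
  set R₀ : ℝ := max (‖x₀‖ + 1) R with hR₀def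
  have hR₀ : 0 < R₀ := lt_of_lt_of_le hR (le_max_right _ _)
  have hRR₀ : R ≤ R₀ := le_max_right _ _
  -- the cutoff field
  obtain ⟨V, hV, ⟨M, hVM⟩, hVle, ⟨K, hK⟩, hagree⟩ := exists_cutoff_local hU2 (R := R₀ + 1) (by linarith)
  have hV1 : ContDiff ℝ 1 V := hV.of_le (by norm_num)
  have hfarV : ∀ y : EuclideanSpace ℝ (Fin 3), R ≤ ‖y‖ → ‖V y‖ ≤ max κ 0 * ‖y‖ :=
    fun y hy => (hVle y).trans (hfarU y hy)
  have hnear : ∀ z : EuclideanSpace ℝ (Fin 3), ‖z‖ ≤ R₀ → V =ᶠ[𝓝 z] U := by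
    intro z hz
    have hmem : ball (0 : EuclideanSpace ℝ (Fin 3)) (R₀ + 1) ∈ 𝓝 z :=
      isOpen_ball.mem_nhds (by rw [mem_ball, dist_zero_right]; linarith)
    exact Filter.eventually_of_mem hmem fun y hy => hagree y hy
  have hDeq : ∀ z : EuclideanSpace ℝ (Fin 3), ‖z‖ ≤ R₀ → fderiv ℝ V z = fderiv ℝ U z :=
    fun z hz => (hnear z hz).fderiv_eq
  have hcurlEq : ∀ z : EuclideanSpace ℝ (Fin 3), ‖z‖ ≤ R₀ → curl V z = curl U z :=
    fun z hz => curl_congr_fderiv (hDeq z hz)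
  have hWeq : ∀ z : EuclideanSpace ℝ (Fin 3), ‖z‖ < R₀ + 1 →
      selfSimilarTransport γ 0 V z = selfSimilarTransport γ 0 U z := by
    intro z hz
    simp only [selfSimilarTransport_apply, hagree z (by rwa [mem_ball, dist_zero_right])]
  set Φ := ODE.evolutionMap (fun _ : ℝ => selfSimilarTransport γ 0 V) 0 with hΦ
  -- the bad set of `V` inside the closed ball `R₀`
  set Bd : Set (EuclideanSpace ℝ (Fin 3)) := {z | z ∈ selfSimilarNodalSet γ 0 V ∧ ‖z‖ ≤ R₀ ∧
    ∃ w : EuclideanSpace ℝ (Fin 3), ‖w‖ = 1 ∧ 1 ≤ ⟪fderiv ℝ V z w, w⟫} with hBd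
  have hBc : IsCompact Bd := by
    have hWc : Continuous (selfSimilarTransport γ 0 V) := (contDiff_selfSimilarTransport (γ := γ) hV).continuous
    have h1 : IsClosed (selfSimilarNodalSet γ 0 V) := isClosed_eq hWc continuous_const
    have h2 : IsClosed {z : EuclideanSpace ℝ (Fin 3) | ‖z‖ ≤ R₀} := isClosed_le continuous_norm continuous_const
    have h3 := isClosed_badSet_of_contDiff hV1
    have hcl : IsClosed Bd := by
      rw [hBd, setOf_and, setOf_and]
      exact h1.inter (h2.inter h3)
    refine (isCompact_closedBall (0 : EuclideanSpace ℝ (Fin 3)) R₀).of_isClosed_subset hcl fun z hz => ?_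
    rw [mem_closedBall, dist_zero_right]; exact hz.2.1
  -- every point of `Bd` is thin for the `V`-flow
  have hthin : ∀ z ∈ Bd, ∃ T : ℝ, 0 < T ∧ ∃ r : ℝ, 0 < r ∧ volume {q : EuclideanSpace ℝ (Fin 3) |
      ∃ qs : ℕ → EuclideanSpace ℝ (Fin 3), qs 0 = q ∧ (∀ k, Φ T (qs (k + 1)) = qs k) ∧ ∀ k, qs k ∈ ball z r} = 0 := by
    rintro z ⟨hzN, hzR, hbad⟩
    by_cases hc : curl V z = 0
    · -- non-vortical: block data from the true profile `U`, transported by `DV z = DU z`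
      have hcU : curl U z = 0 := by rwa [hcurlEq z hzR] at hc
      have hbadU : ∃ w : EuclideanSpace ℝ (Fin 3), ‖w‖ = 1 ∧ 1 ≤ ⟪fderiv ℝ U z w, w⟫ := by
        rw [← hDeq z hzR]; exact hbad
      obtain ⟨b, lam, β, hA0, hA1, hA2, hshape⟩ :=
        exists_thinBlock_of_curl_eq_zero_of_bad (hU1.differentiable one_ne_zero) hprof.divFree hγ2 hcU hbadU
      rw [← hDeq z hzR] at hA0 hA1 hA2
      rcases hshape with ⟨h2, h20, h21⟩ | ⟨h0, h1, h02, h12⟩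
      · exact C2.Kelvin.exists_trappedSet_null_of_dominatedBlock hV hK hzN b lam β hA0 hA1 hA2 h2 h20 h21
      · exact C2.Kelvin.exists_trappedSet_null_of_contractingPlane hV hK hzN b lam β hA0 hA1 hA2 h0 h1 h02 h12
    · -- vortical: pointwise profile facts from `U`
      have hzNU : z ∈ selfSimilarNodalSet γ 0 U := by
        rw [mem_selfSimilarNodalSet_iff] at hzN ⊢
        have := hWeq z (by linarith)
        simp only [selfSimilarTransport_apply] at this
        rwa [this] at hzN
      have heig : fderiv ℝ V z (curl V z) = curl V z := by
        rw [hDeq z hzR, hcurlEq z hzR]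
        exact hprof.isSelfSimilarEulerVorticityProfile.fderiv_apply_curl_eq_of_mem_nodalSet hzNU
      have hdivz : LinearMap.trace ℝ _ ((fderiv ℝ V z : EuclideanSpace ℝ (Fin 3) →L[ℝ] EuclideanSpace ℝ (Fin 3)) :
          EuclideanSpace ℝ (Fin 3) →ₗ[ℝ] EuclideanSpace ℝ (Fin 3)) = 0 := by
        rw [hDeq z hzR]; exact hprof.divFree z
      exact exists_trappedSet_null_of_curl_ne_zero_loc hV hK (by linarith) hγ2 hzN hc heig hdivz
  have hnull := C2.Kelvin.volume_setOf_tendsto_flow_atBot_mem_eq_zero_of_trappedSets hV hK hBc hthin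
  -- every vortical point near `x₀` flows backward into `Bd`
  have hsubset : {x : EuclideanSpace ℝ (Fin 3) | dist x x₀ < 1 ∧ curl U x ≠ 0} ⊆
      {x : EuclideanSpace ℝ (Fin 3) | ∃ z ∈ Bd, Tendsto (fun s => Φ s x) atBot (𝓝 z)} := by
    rintro x ⟨hx, hcx⟩
    have hxn : ‖x‖ ≤ ‖x₀‖ + 1 := by
      have := norm_le_norm_add_norm_sub' x x₀
      rw [← dist_eq_norm] at this
      linarith
    have hxR : max ‖x‖ R ≤ R₀ := max_le (hxn.trans (le_max_left _ _)) hRR₀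
    -- the backward half-orbit and its BARRIER confinement
    set Yp : ℝ → EuclideanSpace ℝ (Fin 3) := fun t => Φ (-t) x with hYp
    have hYpV : ∀ t, HasDerivAt Yp ((-1 : ℝ) • selfSimilarTransport γ 0 V (Yp t)) t :=
      fun t => C2.Kelvin.hasDerivAt_flow_neg (γ := γ) hV1 hK x t
    have hconf : ∀ t, 0 ≤ t → ‖Yp t‖ ≤ R₀ :=
      fun t ht => (norm_flow_le_max_of_nonpos_of_lt hV1 hK hκ0 hR hfarV x (s := -t) (by linarith)).trans hxR
    have hYpU : ∀ t, 0 ≤ t → HasDerivAt Yp ((-1 : ℝ) • selfSimilarTransport γ 0 U (Yp t)) t := by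
      intro t ht
      have h := hYpV t
      rwa [hWeq (Yp t) (by linarith [hconf t ht])] at h
    -- a global `W_U`-curve extending it
    have hWU1 : ContDiff ℝ 1 (selfSimilarTransport γ 0 U) := contDiff_selfSimilarTransport (γ := γ) hU1
    have hgrowth : ∀ y, ‖selfSimilarTransport γ 0 U y‖ ≤ (γ + max κ 0) * ‖y‖ + max B 0 := by
      intro y
      rw [selfSimilarTransport_apply, sub_zero]
      calc ‖γ • y + U y‖ ≤ ‖γ • y‖ + ‖U y‖ := norm_add_le _ _
        _ ≤ γ * ‖y‖ + (max κ 0 * ‖y‖ + max B 0) := by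
            rw [norm_smul, Real.norm_of_nonneg hγ.le]; exact add_le_add le_rfl (hUlin y)
        _ = (γ + max κ 0) * ‖y‖ + max B 0 := by ring
    obtain ⟨Y, hYeq, hY⟩ := exists_hasDerivAt_extension_of_linearGrowth hWU1
      (add_nonneg hγ.le (le_max_right _ _)) hB0 hgrowth hYpU
    have hBdY : ∀ t, 0 ≤ t → ‖Y t‖ ≤ R₀ := fun t ht => by rw [hYeq t ht]; exact hconf t ht
    have hY0 : Y 0 = x := by
      rw [hYeq 0 le_rfl, hYp]
      simp only [neg_zero, hΦ, ODE.evolutionMap_self]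
    have hx0 : curl U (Y 0) ≠ 0 := by rw [hY0]; exact hcx
    -- ns-typeII-p1's limit-set kill on the `U`-curve
    obtain ⟨z', hz'N, hz'R, hcl', w, hw, hbadw⟩ :=
      NodalContinuum.exists_mapClusterPt_stretching_ge_one hprof (ne_of_lt hγ2) hY hBdY hx0
    -- transfer to the `V`-orbit
    have hEq : Y =ᶠ[atTop] Yp := (eventually_ge_atTop (0 : ℝ)).mono fun t ht => hYeq t ht
    have hclYp : MapClusterPt z' atTop Yp := by
      have hmap : map Y atTop = map Yp atTop := Filter.map_congr hEq
      unfold MapClusterPt at hcl' ⊢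
      rwa [hmap] at hcl'
    have hcl : MapClusterPt z' atBot (fun s => Φ s x) := by
      have e : Yp = (fun s => Φ s x) ∘ Neg.neg := rfl
      rw [e, mapClusterPt_comp, Filter.map_neg_atTop] at hclYp
      exact hclYp
    -- point hypotheses from the profile along the `U`-curve
    have hWeqt : ∀ t, 0 ≤ t → selfSimilarTransport γ 0 U (Y t) = selfSimilarTransport γ 0 V (Yp t) := by
      intro t ht
      rw [hYeq t ht, hWeq (Yp t) (by linarith [hconf t ht])]
    have htendsU := hprof.tendsto_transport_comp_of_bounded (ne_of_lt hγ2) (σ := -1) (by norm_num) hY hBdY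
    have htendsYp : Tendsto (fun t => selfSimilarTransport γ 0 V (Yp t)) atTop (𝓝 0) :=
      htendsU.congr' ((eventually_ge_atTop (0 : ℝ)).mono fun t ht => hWeqt t ht)
    have htends : Tendsto (fun s => selfSimilarTransport γ 0 V (Φ s x)) atBot (𝓝 0) := by
      have h := htendsYp.comp tendsto_neg_atBot_atTop
      refine h.congr fun s => ?_
      simp only [Function.comp_apply, hYp, neg_neg]
    obtain ⟨C, hC⟩ := hprof.exists_integral_norm_transport_sq_le (ne_of_lt hγ2) (σ := -1) (by norm_num) hY hBdY
    have hcont : Continuous fun t : ℝ => ‖selfSimilarTransport γ 0 V (Φ (-t) x)‖ ^ 2 :=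
      ((((contDiff_selfSimilarTransport (γ := γ) hV).continuous.comp
        ((C2.Kelvin.continuous_flow_apply (γ := γ) hV1 hK x).comp continuous_neg)).norm).pow 2)
    have hint : IntegrableOn (fun t : ℝ => ‖selfSimilarTransport γ 0 V (Φ (-t) x)‖ ^ 2) (Ioi 0) := by
      refine integrableOn_Ioi_of_intervalIntegral_norm_bounded C 0 (l := atTop) (b := fun n : ℕ => (n : ℝ))
        (fun n => (hcont.integrableOn_Icc).mono_set Ioc_subset_Icc_self) tendsto_natCast_atTop_atTop ?_
      refine Eventually.of_forall fun n => ?_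
      have h := hC 0 n le_rfl (Nat.cast_nonneg n)
      refine le_trans (le_of_eq ?_) h
      refine intervalIntegral.integral_congr fun t ht => ?_
      rw [uIcc_of_le (Nat.cast_nonneg n)] at ht
      simp only [Real.norm_eq_abs, abs_pow, abs_norm]
      rw [hWeqt t ht.1]
    -- node facts at `z'`
    have hDz : fderiv ℝ V z' = fderiv ℝ U z' := hDeq z' hz'R
    have hz'NV : z' ∈ selfSimilarNodalSet γ 0 V := by
      rw [mem_selfSimilarNodalSet_iff] at hz'N ⊢
      have := hWeq z' (by linarith)
      simp only [selfSimilarTransport_apply] at this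
      rwa [← this] at hz'N
    have hdiv0 : LinearMap.trace ℝ _ ((fderiv ℝ V z' : EuclideanSpace ℝ (Fin 3) →L[ℝ] EuclideanSpace ℝ (Fin 3)) :
        EuclideanSpace ℝ (Fin 3) →ₗ[ℝ] EuclideanSpace ℝ (Fin 3)) = 0 := by
      rw [hDz]; exact hprof.divFree z'
    have heig : curl V z' ≠ 0 → fderiv ℝ V z' (curl V z') = curl V z' := fun _ => by
      rw [hDz, hcurlEq z' hz'R]
      exact hprof.isSelfSimilarEulerVorticityProfile.fderiv_apply_curl_eq_of_mem_nodalSet hz'N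
    have hbadV : 1 ≤ ⟪fderiv ℝ V z' w, w⟫ := by rw [hDz]; exact hbadw
    obtain ⟨z, hzN, hz⟩ := tendsto_flow_atBot_of_badClusterPt_loc hV hK hVM hγ hγ2 x htends hint hcl hdiv0 heig hw hbadV
    have hzz' : z' = z := eq_of_nhds_neBot (hcl.clusterPt.mono hz)
    exact ⟨z, ⟨hzN, hzz' ▸ hz'R, w, hw, hzz' ▸ hbadV⟩, hz⟩
  -- an open null set is empty
  have hopen : IsOpen {x : EuclideanSpace ℝ (Fin 3) | dist x x₀ < 1 ∧ curl U x ≠ 0} := by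
    have h1 : IsOpen {x : EuclideanSpace ℝ (Fin 3) | dist x x₀ < 1} := isOpen_lt (continuous_id.dist continuous_const) continuous_const
    exact h1.inter (isOpen_ne_fun (differentiable_curl_of_contDiff hU2).continuous continuous_const)
  have hzero : volume {x : EuclideanSpace ℝ (Fin 3) | dist x x₀ < 1 ∧ curl U x ≠ 0} = 0 := measure_mono_null hsubset hnull
  have hempty := (hopen.measure_eq_zero_iff volume).1 hzero
  by_contra hx₀
  have : x₀ ∈ ({x : EuclideanSpace ℝ (Fin 3) | dist x x₀ < 1 ∧ curl U x ≠ 0} : Set _) := ⟨by simp, hx₀⟩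
  rw [hempty] at this
  exact this

end Summit.NavierStokesRegularity.NavierStokesRegularity.Theorems.PowerGaugeEulerLiouville.Loc

end
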